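import Literature.MathematicalPhysics.QuantumFieldTheory.Balaban1983to89.B6Eq295

/-!
# `Balaban1983to89.B6Eq242LocalPropagator` — T. Bałaban, *Propagators and renormalization transformations for lattice
gauge theories. II*, Commun. Math. Phys. **96** (1984) 223–250 [Balaban1984PropagatorsII]: the local two-level propagator
`G′(□)` of a cube meeting `B^j(Λ_j)` and `B^{j+1}(Λ_{j+1})`, **(2.41)–(2.42)** p. 230 — the operator content PROVED as a
Woodbury identity over abstract modules, and the printed Gaussian route PROVED line by line over left-invariant measures

statement-level skeleton of published theorems with citation tags; proofs where landed; nothing here is a claim about the Yang–Mills mass gap.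
PDF held: `paper:balaban1984-cmp96-propagators-rt-ii` (journal page = PDF page + 222); p. 230 [PDF 8] read from the ×2
render `run/shared/lean/pub/pub-balaban/b2b-balaban-ref1/pages/1984-cmp96-propagators-rt-II/1984-cmp96-propagators-rt-II-p008-x2.png`.

CITATION HEADER (cell `lit-balaban`, unit `lit-balaban-r03` gen 2 — B6 reader; SKELETON row `B6.Eq2.41` of
`HOME/lit-balaban-r03/ROWS-B6.md`; knitting file announced `TAKING B6.Eq2.41` in HOME/STATUS.md 2026-08-21T01:00Z).
IMPORTED, not modified: `…B6Eq295` (r03, for `integral_exp_quadratic_add_linear`: the Gaussian translation step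
`∫e^{−½⟨x,Mx⟩+⟨x,J⟩} = e^{½⟨J,GJ⟩}∫e^{−½⟨x,Mx⟩}` for `M` symmetric, `MG = I`, any left-invariant measure, NO integrability
hypothesis).
WHAT THE PAPER PRINTS (p. 230, verbatim).  *"If □ intersects both domains B^j(Λ_j) and B^{j+1}(Λ_{j+1}), then we express
G′(□) in terms of operators introduced in the paper. On the basis of the formulas (2.12), (2.13) [1] we have
e^{½⟨f,G′(□)f⟩} = Z⁻¹∫dλ exp[−½⟨λ,(Δ_□^{L^{−j},N} + Q′*aQ′↾_□)λ⟩ + ⟨λ,f⟩]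
 = Z′⁻¹∫dω↾_Λ exp[−½aL^{d−2}Σ_{y∈Λ′}|(Q′ω)(y)|²] · ∫dλ exp[−½a_j‖ω − Q′_jλ‖² − ½⟨λ,Δ_□^{L^{−j},N}λ⟩ + ⟨λ,f⟩], (2.41)
where Λ = □^{(j)} ∩ B(Λ_{j+1}) and ω is equal to 0 beyond Λ. Further, we have after the translation λ → λ + G′_j(□)Q′_j*ω
e^{½⟨f,G′(□)f⟩} = Z′⁻¹∫dω↾_Λ exp[−½aL^{−2}⟨ω,Q′*Q′ω⟩ − ½a_j‖ω‖² + ½a_j²⟨ω,Q′_jG′_j(□)Q′_j*ω⟩ + ⟨ω,Q′_jG′_j(□)f⟩]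
   · ∫dλ exp[−½⟨λ,(G′_j(□))⁻¹λ⟩ + ⟨λ,f⟩]
 = e^{½⟨f,G′_j(□)f⟩}Z′⁻¹∫dω↾_Λ exp[−½⟨ω,(C_Λ^{(j)}(□))⁻¹ω⟩ + ⟨ω,Q′_jG′_j(□)f⟩]
 = exp[½⟨f,G′_j(□)f⟩ + ⟨f,G′_j(□)Q′_j*C_Λ^{(j)}(□)Q′_jG′_j(□)f⟩]. (2.42)"*
DICTIONARY (abstract carriers).  `V` = the fields `λ` on `□` (real inner-product space, left-invariant `μ` = dλ);
`W` = the fields `ω` on `Λ` (left-invariant `ν` = dω↾_Λ); `U` = the level-`j` block fields on `□^{(j)}`; `lap` = Δ_□^{L^{−j},N}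
(symmetric); `Qj : V → U` = Q′_j with adjoint `Qjs`; `emb : W → U` = *"ω is equal to 0 beyond Λ"* (extension by zero) with
adjoint `embs` (restriction to Λ); `Bq : W → W` symmetric = the form `aL^{d−2}Σ_{y∈Λ′}|(Q′ω)(y)|²` (= `aL^{−2}⟨ω,Q′*Q′ω⟩`);
`aj` = a_j; `Mj = lap + a_jQ′_j*Q′_j` with two-sided inverse `Gj` = G′_j(□) ([3] Lemma 2.2); `B₀ = Bq + a_j·embs∘emb`;
`Cinv = B₀ − a_j²·embs Q′_j G′_j Q′_j* emb` with two-sided inverse `C` = C_Λ^{(j)}(□); the effective two-level averaging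
form `K = a_j − a_j²·emb B₀⁻¹ embs` on `U`, `deltaPrimeBox = lap + Q′_j*KQ′_j` = Δ_□ + Q′*aQ′↾_□ GIVEN the identification
of [1] (2.12)–(2.13) (row B1.Eq2.12, `…B1RT.display212`, seat r14: integrating the intermediate field ω reproduces the
next-level Gaussian weight — here kept abstract as the ω-representation `eq241_fibre`), and
`gPrimeBox = Gj + a_j²·Gj Q′_j* emb C embs Q′_j Gj` = G′(□).
WHAT IS PROVED HERE (0 sorry, 0 named facts).
§1 (any commutative ring of scalars, no analysis): `deltaPrimeBox_comp_gPrimeBox` — the Woodbury identity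
`(Mj − a_j²Q′_j*emb B₀⁻¹embs Q′_j)(Gj + a_j²Gj Q′_j*emb C embs Q′_j Gj) = I` from `MjGj = I`, `B₀⁻¹B₀ = I`, `C⁻¹C = I`,
i.e. **G′(□) IS a right inverse of Δ_□ + Q′*aQ′↾_□** (`deltaPrimeBox_eq`: Δ_□ + Q′_j*KQ′_j = Mj − a_j²Q′_j*emb B₀⁻¹embs Q′_j).
§2 (real inner-product spaces): `form242` — `⟨f,G′(□)f⟩ = ⟨f,G′_jf⟩ + a_j²⟨Q′_jG′_jf, emb C embs Q′_jG′_jf⟩`, the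
exponent of the last line of (2.42) with its coefficient.
§3 (left-invariant measures `dλ`, `dω`; NO integrability hypothesis — both sides vanish together): `exponent241` (the
λ-exponent of (2.41) is the Gaussian of `Mj` with source `f + a_jQ′_j*emb ω`); `eq242_inner` — the λ-integral of the
second line of (2.41) after the translation `λ → λ + a_jG′_jQ′_j*ω` (first line of (2.42)):
`∫dλ exp[−½a_j‖emb ω − Q′_jλ‖² − ½⟨λ,Δλ⟩ + ⟨λ,f⟩] = exp[½⟨f,G′_jf⟩ − ½a_j‖emb ω‖² + ½a_j²⟨Q′_j*emb ω,G′_jQ′_j*emb ω⟩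
+ a_j⟨Q′_j*emb ω,G′_jf⟩]·Z_j`; `eq242_outer` — the ω-integral (second and third lines of (2.42)):
`∫dω exp[−½⟨ω,C⁻¹ω⟩ + a_j⟨ω,g⟩] = exp[½a_j²⟨g,Cg⟩]·Z_C`; `eq242` — assembled in the printed (iterated) order:
`∫dω e^{−½⟨ω,Bqω⟩}∫dλ(…) = exp[½⟨f,G′_jf⟩ + ½a_j²⟨embs Q′_jG′_jf, C embs Q′_jG′_jf⟩]·Z_jZ_C`, and `eq242_gPrimeBox`:
the same `= e^{½⟨f,G′(□)f⟩}·Z_jZ_C` with the Woodbury `G′(□)` of §1 (by `form242`).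
§4 `eq241_fibre` — the ω-representation behind the second equality of (2.41): for every block field `u`,
`∫dω exp[−½⟨ω,Bqω⟩ − ½a_j‖emb ω − u‖²] = exp[−½⟨u,Ku⟩]·Z_{B₀}`, so the λ-integrand of the first line of (2.41) with
`Q′*aQ′↾_□ := Q′_j*KQ′_j` is `Z_{B₀}⁻¹ ×` the ω-integral of the second line, pointwise in λ.
LOCATED COEFFICIENT BOOKKEEPING (cell GAPS G-B6-03, reader note 4 of `ROWS-B6.md`; no consumer affected, (2.43) is
qualitative): the printed translation *"λ → λ + G′_j(□)Q′_j*ω"* and cross term *"⟨ω,Q′_jG′_j(□)f⟩"* carry `a_jG′_jQ′_j*ω`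
and `a_j⟨ω,Q′_jG′_jf⟩` when the square is completed exactly (`eq242_inner`), and the last line of (2.42) then reads
`exp[½⟨f,G′_jf⟩ + ½a_j²⟨f,G′_jQ′_j*CQ′_jG′_jf⟩]` (`form242`/`eq242`) where print has `⟨f,G′_jQ′_j*CQ′_jG′_jf⟩` without
`½a_j²`; the printed `−½a_j‖ω‖²` is `−½a_j‖emb ω‖²` (equal for the extension by zero, `embs∘emb = I`, not assumed here).
NOT CLAIMED: the identification `Q′*aQ′↾_□ = Q′_j*KQ′_j` itself (row B1.Eq2.12), the estimates (2.43)–(2.44), Fubini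
between the two iterated orders of (2.41) (each line is proved in the order printed).
-/

noncomputable section

open MeasureTheory
open scoped InnerProductSpace

namespace Literature.MathematicalPhysics.QuantumFieldTheory.Balaban1983to89.B6Eq242LocalPropagator

/-! ## §1. The operator content of (2.42): `G′(□)` by the Woodbury identity -/

section Algebra

variable {R : Type*} [CommRing R]
variable {V W U : Type*} [AddCommGroup V] [Module R V] [AddCommGroup W] [Module R W] [AddCommGroup U] [Module R U]

/-- `M_j = Δ_□ + a_jQ′_j*Q′_j` — the ONE-level operator of the cube whose inverse is `G′_j(□)` ([3] Lemma 2.2).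
[cite: Balaban1984PropagatorsII, (2.41)–(2.42) p.230] -/
def mj (lap : V →ₗ[R] V) (Qj : V →ₗ[R] U) (Qjs : U →ₗ[R] V) (aj : R) : V →ₗ[R] V :=
  lap + aj • (Qjs ∘ₗ Qj)

/-- `B₀ = Bq + a_j·embs∘emb` — the ω-quadratic form of (2.41) collected: `aL^{d−2}Σ|Q′ω|² + a_j‖emb ω‖²`.
[cite: Balaban1984PropagatorsII, (2.41) p.230] -/
def b0 (Bq : W →ₗ[R] W) (emb : W →ₗ[R] U) (embs : U →ₗ[R] W) (aj : R) : W →ₗ[R] W :=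
  Bq + aj • (embs ∘ₗ emb)

/-- `K = a_j − a_j²·emb B₀⁻¹ embs` — the effective two-level averaging form on the level-`j` block fields obtained by
integrating out ω ((2.41) with [1] (2.12)–(2.13); `eq241_fibre`). [cite: Balaban1984PropagatorsII, (2.41) p.230] -/
def kForm (emb : W →ₗ[R] U) (embs : U →ₗ[R] W) (B0inv : W →ₗ[R] W) (aj : R) : U →ₗ[R] U :=
  aj • LinearMap.id - (aj * aj) • (emb ∘ₗ B0inv ∘ₗ embs)

/-- `Δ_□ + Q′*aQ′↾_□ = Δ_□ + Q′_j*KQ′_j` — the two-level operator of the cube whose inverse is `G′(□)`.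
[cite: Balaban1984PropagatorsII, (2.41) p.230] -/
def deltaPrimeBox (lap : V →ₗ[R] V) (Qj : V →ₗ[R] U) (Qjs : U →ₗ[R] V) (emb : W →ₗ[R] U) (embs : U →ₗ[R] W)
    (B0inv : W →ₗ[R] W) (aj : R) : V →ₗ[R] V :=
  lap + Qjs ∘ₗ kForm emb embs B0inv aj ∘ₗ Qj

/-- `(C_Λ^{(j)}(□))⁻¹ = B₀ − a_j²·embs Q′_jG′_jQ′_j* emb` — the ω-form after the translation of (2.42) (second line).
[cite: Balaban1984PropagatorsII, (2.42) p.230] -/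
def cInv (Qj : V →ₗ[R] U) (Qjs : U →ₗ[R] V) (emb : W →ₗ[R] U) (embs : U →ₗ[R] W) (Bq : W →ₗ[R] W)
    (Gj : V →ₗ[R] V) (aj : R) : W →ₗ[R] W :=
  b0 Bq emb embs aj - (aj * aj) • (embs ∘ₗ Qj ∘ₗ Gj ∘ₗ Qjs ∘ₗ emb)

/-- `G′(□) = G′_j(□) + a_j²·G′_j(□)Q′_j* emb C_Λ^{(j)}(□) embs Q′_jG′_j(□)` — the operator in the last line of (2.42).
[cite: Balaban1984PropagatorsII, (2.42) p.230] -/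
def gPrimeBox (Qj : V →ₗ[R] U) (Qjs : U →ₗ[R] V) (emb : W →ₗ[R] U) (embs : U →ₗ[R] W) (Gj : V →ₗ[R] V)
    (C : W →ₗ[R] W) (aj : R) : V →ₗ[R] V :=
  Gj + (aj * aj) • (Gj ∘ₗ Qjs ∘ₗ emb ∘ₗ C ∘ₗ embs ∘ₗ Qj ∘ₗ Gj)

/-- `Δ_□ + Q′_j*KQ′_j = M_j − a_j²·Q′_j*emb B₀⁻¹ embs Q′_j` (expanding `K`). [cite: Balaban1984PropagatorsII, (2.41) p.230] -/
theorem deltaPrimeBox_eq (lap : V →ₗ[R] V) (Qj : V →ₗ[R] U) (Qjs : U →ₗ[R] V) (emb : W →ₗ[R] U)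
    (embs : U →ₗ[R] W) (B0inv : W →ₗ[R] W) (aj : R) :
    deltaPrimeBox lap Qj Qjs emb embs B0inv aj =
      mj lap Qj Qjs aj - (aj * aj) • (Qjs ∘ₗ emb ∘ₗ B0inv ∘ₗ embs ∘ₗ Qj) := by
  ext v
  simp only [deltaPrimeBox, mj, kForm, LinearMap.add_apply, LinearMap.sub_apply, LinearMap.smul_apply,
    LinearMap.comp_apply, LinearMap.id_apply, map_sub, map_smul]
  abel

/-- **(2.42), operator content (Woodbury identity): `G′(□)` is a right inverse of `Δ_□ + Q′*aQ′↾_□`.**  Hypotheses: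
`M_jG′_j = I`, `B₀⁻¹B₀ = I`, `C⁻¹C = I` (one-sided inverses suffice). [cite: Balaban1984PropagatorsII, (2.41)–(2.42) p.230] -/
theorem deltaPrimeBox_comp_gPrimeBox (lap : V →ₗ[R] V) (Qj : V →ₗ[R] U) (Qjs : U →ₗ[R] V) (emb : W →ₗ[R] U)
    (embs : U →ₗ[R] W) (Bq B0inv : W →ₗ[R] W) (Gj : V →ₗ[R] V) (C : W →ₗ[R] W) (aj : R)
    (hG : mj lap Qj Qjs aj ∘ₗ Gj = LinearMap.id) (hB : B0inv ∘ₗ b0 Bq emb embs aj = LinearMap.id)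
    (hC : cInv Qj Qjs emb embs Bq Gj aj ∘ₗ C = LinearMap.id) :
    deltaPrimeBox lap Qj Qjs emb embs B0inv aj ∘ₗ gPrimeBox Qj Qjs emb embs Gj C aj = LinearMap.id := by
  have hMG : ∀ v, mj lap Qj Qjs aj (Gj v) = v := fun v => by simpa using LinearMap.congr_fun hG v
  have hBB : ∀ w, B0inv (b0 Bq emb embs aj w) = w := fun w => by simpa using LinearMap.congr_fun hB w
  have hCC : ∀ w, cInv Qj Qjs emb embs Bq Gj aj (C w) = w := fun w => by simpa using LinearMap.congr_fun hC w
  -- from C⁻¹C = I:  a_j²·(embs Q′_j G′_j Q′_j* emb)(C w) = B₀(C w) − w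
  have h1 : ∀ w, (aj * aj) • embs (Qj (Gj (Qjs (emb (C w))))) = b0 Bq emb embs aj (C w) - w := by
    intro w
    have h := hCC w
    simp only [cInv, LinearMap.sub_apply, LinearMap.smul_apply, LinearMap.comp_apply] at h
    calc (aj * aj) • embs (Qj (Gj (Qjs (emb (C w)))))
        = b0 Bq emb embs aj (C w) -
            (b0 Bq emb embs aj (C w) - (aj * aj) • embs (Qj (Gj (Qjs (emb (C w)))))) := by abel
      _ = b0 Bq emb embs aj (C w) - w := by rw [h]
  -- apply B₀⁻¹ and then Q′_j* emb:  a_j²·Q′_j* emb B₀⁻¹ embs Q′_j G′_j Q′_j* emb C w = Q′_j* emb (C w − B₀⁻¹ w)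
  have h2 : ∀ w, (aj * aj) • Qjs (emb (B0inv (embs (Qj (Gj (Qjs (emb (C w)))))))) =
      Qjs (emb (C w)) - Qjs (emb (B0inv w)) := by
    intro w
    have h := congrArg (fun x => Qjs (emb (B0inv x))) (h1 w)
    simp only [map_smul, map_sub, hBB] at h
    exact h
  ext v
  rw [LinearMap.comp_apply, LinearMap.id_apply, deltaPrimeBox_eq]
  simp only [gPrimeBox, LinearMap.sub_apply, LinearMap.add_apply, LinearMap.smul_apply, LinearMap.comp_apply,
    map_add, map_smul, hMG, h2 (embs (Qj (Gj v))), smul_sub]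
  abel

end Algebra

/-! ## §2. The quadratic form of `G′(□)` — the last line of (2.42) with its coefficient -/

/-- adjointness read from the other side: `⟨v, S u⟩ = ⟨T v, u⟩` when `⟨S u, v⟩ = ⟨u, T v⟩`. [folklore] -/
private theorem adj_swap {E F : Type*} [NormedAddCommGroup E] [InnerProductSpace ℝ E] [NormedAddCommGroup F]
    [InnerProductSpace ℝ F] (S : F →ₗ[ℝ] E) (T : E →ₗ[ℝ] F) (h : ∀ (u : F) (v : E), ⟪S u, v⟫_ℝ = ⟪u, T v⟫_ℝ)
    (u : F) (v : E) : ⟪v, S u⟫_ℝ = ⟪T v, u⟫_ℝ := by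
  rw [real_inner_comm, h, real_inner_comm]

section Form

variable {V W U : Type*} [NormedAddCommGroup V] [InnerProductSpace ℝ V] [NormedAddCommGroup W]
  [InnerProductSpace ℝ W] [NormedAddCommGroup U] [InnerProductSpace ℝ U]

/-- **`⟨f,G′(□)f⟩ = ⟨f,G′_jf⟩ + a_j²⟨Q′_jG′_jf, emb C embs Q′_jG′_jf⟩`** for `G′_j` symmetric and `Q′_j*` the adjoint of
`Q′_j` (the exponent of the last line of (2.42); print omits the factor `½a_j²` in front of the second term, GAPS G-B6-03).
[cite: Balaban1984PropagatorsII, (2.42) p.230] -/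
theorem form242 (Qj : V →ₗ[ℝ] U) (Qjs : U →ₗ[ℝ] V) (emb : W →ₗ[ℝ] U) (embs : U →ₗ[ℝ] W) (Gj : V →ₗ[ℝ] V)
    (C : W →ₗ[ℝ] W) (aj : ℝ) (hQ : ∀ (u : U) (v : V), ⟪Qjs u, v⟫_ℝ = ⟪u, Qj v⟫_ℝ)
    (hGsym : ∀ x y : V, ⟪Gj x, y⟫_ℝ = ⟪x, Gj y⟫_ℝ) (f : V) :
    ⟪f, gPrimeBox Qj Qjs emb embs Gj C aj f⟫_ℝ =
      ⟪f, Gj f⟫_ℝ + aj * aj * ⟪Qj (Gj f), emb (C (embs (Qj (Gj f))))⟫_ℝ := by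
  have h : ⟪f, Gj (Qjs (emb (C (embs (Qj (Gj f))))))⟫_ℝ = ⟪Qj (Gj f), emb (C (embs (Qj (Gj f))))⟫_ℝ := by
    rw [← hGsym, adj_swap Qjs Qj hQ]
  simp only [gPrimeBox, LinearMap.add_apply, LinearMap.smul_apply, LinearMap.comp_apply, inner_add_right,
    inner_smul_right, h]

end Form

/-! ## §3. The printed Gaussian route: (2.41) second line → (2.42), by translations -/

section Gaussian

variable {V W U : Type*} [NormedAddCommGroup V] [InnerProductSpace ℝ V] [MeasurableSpace V] [MeasurableAdd V]
  [NormedAddCommGroup W] [InnerProductSpace ℝ W] [MeasurableSpace W] [MeasurableAdd W]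
  [NormedAddCommGroup U] [InnerProductSpace ℝ U]

omit [MeasurableSpace V] [MeasurableAdd V] [MeasurableSpace W] [MeasurableAdd W] in
/-- The λ-exponent of the second line of (2.41) is a Gaussian in λ with operator `M_j = Δ + a_jQ′_j*Q′_j` and source
`f + a_jQ′_j*emb ω`:  `−½a_j‖emb ω − Q′_jλ‖² − ½⟨λ,Δλ⟩ + ⟨λ,f⟩ = −½⟨λ,M_jλ⟩ + ⟨λ, f + a_jQ′_j*emb ω⟩ − ½a_j‖emb ω‖²`.
[cite: Balaban1984PropagatorsII, (2.41)–(2.42) p.230] -/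
theorem exponent241 (lap : V →ₗ[ℝ] V) (Qj : V →ₗ[ℝ] U) (Qjs : U →ₗ[ℝ] V) (emb : W →ₗ[ℝ] U) (aj : ℝ)
    (hQ : ∀ (u : U) (v : V), ⟪Qjs u, v⟫_ℝ = ⟪u, Qj v⟫_ℝ) (ω : W) (f l : V) :
    -(1 / 2) * aj * ‖emb ω - Qj l‖ ^ 2 - (1 / 2) * ⟪l, lap l⟫_ℝ + ⟪l, f⟫_ℝ =
      -(1 / 2) * ⟪l, mj lap Qj Qjs aj l⟫_ℝ + ⟪l, f + aj • Qjs (emb ω)⟫_ℝ - (1 / 2) * aj * ‖emb ω‖ ^ 2 := by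
  have h1 : ⟪l, Qjs (Qj l)⟫_ℝ = ‖Qj l‖ ^ 2 := by
    rw [real_inner_comm, hQ, real_inner_self_eq_norm_sq]
  have h2 : ⟪l, Qjs (emb ω)⟫_ℝ = ⟪emb ω, Qj l⟫_ℝ := by rw [real_inner_comm, hQ]
  have h3 : ‖emb ω - Qj l‖ ^ 2 = ‖emb ω‖ ^ 2 - 2 * ⟪emb ω, Qj l⟫_ℝ + ‖Qj l‖ ^ 2 :=
    norm_sub_sq_real (emb ω) (Qj l)
  simp only [mj, LinearMap.add_apply, LinearMap.smul_apply, LinearMap.comp_apply, inner_add_right,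
    inner_smul_right, h1, h2, h3]
  ring

omit [MeasurableSpace W] [MeasurableAdd W] in
/-- **(2.42), first line (the λ-integral after the translation `λ → λ + a_jG′_j(□)Q′_j*ω`).**  For `Δ` symmetric,
`Q′_j*` the adjoint of `Q′_j`, `G′_j` a right inverse of `M_j = Δ + a_jQ′_j*Q′_j`, symmetric, and ANY left-invariant `dλ`:
`∫dλ exp[−½a_j‖emb ω − Q′_jλ‖² − ½⟨λ,Δλ⟩ + ⟨λ,f⟩]`
`= exp[½⟨f,G′_jf⟩ − ½a_j‖emb ω‖² + ½a_j²⟨Q′_j*emb ω, G′_jQ′_j*emb ω⟩ + a_j⟨Q′_j*emb ω, G′_jf⟩] · ∫dλ exp[−½⟨λ,M_jλ⟩]`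
(print: the same with `⟨ω,Q′_jG′_j(□)f⟩` for the last exponent term and `∫dλ exp[−½⟨λ,(G′_j(□))⁻¹λ⟩ + ⟨λ,f⟩]`
`= e^{½⟨f,G′_jf⟩}∫dλ e^{−½⟨λ,M_jλ⟩}` for the last factor).  No integrability hypothesis.
[cite: Balaban1984PropagatorsII, (2.42) p.230] -/
theorem eq242_inner (μ : Measure V) [μ.IsAddLeftInvariant] (lap : V →ₗ[ℝ] V) (Qj : V →ₗ[ℝ] U) (Qjs : U →ₗ[ℝ] V)
    (emb : W →ₗ[ℝ] U) (Gj : V →ₗ[ℝ] V) (aj : ℝ) (hQ : ∀ (u : U) (v : V), ⟪Qjs u, v⟫_ℝ = ⟪u, Qj v⟫_ℝ)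
    (hlap : ∀ x y : V, ⟪lap x, y⟫_ℝ = ⟪x, lap y⟫_ℝ) (hG : mj lap Qj Qjs aj ∘ₗ Gj = LinearMap.id)
    (hGsym : ∀ x y : V, ⟪Gj x, y⟫_ℝ = ⟪x, Gj y⟫_ℝ) (ω : W) (f : V) :
    ∫ l, Real.exp (-(1 / 2) * aj * ‖emb ω - Qj l‖ ^ 2 - (1 / 2) * ⟪l, lap l⟫_ℝ + ⟪l, f⟫_ℝ) ∂μ =
      Real.exp ((1 / 2) * ⟪f, Gj f⟫_ℝ - (1 / 2) * aj * ‖emb ω‖ ^ 2 +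
          (1 / 2) * (aj * aj) * ⟪Qjs (emb ω), Gj (Qjs (emb ω))⟫_ℝ + aj * ⟪Qjs (emb ω), Gj f⟫_ℝ) *
        ∫ l, Real.exp (-(1 / 2) * ⟪l, mj lap Qj Qjs aj l⟫_ℝ) ∂μ := by
  -- M_j is symmetric
  have hMsym : ∀ x y : V, ⟪mj lap Qj Qjs aj x, y⟫_ℝ = ⟪x, mj lap Qj Qjs aj y⟫_ℝ := by
    intro x y
    have hxy : ⟪Qjs (Qj x), y⟫_ℝ = ⟪x, Qjs (Qj y)⟫_ℝ := by
      rw [hQ, ← adj_swap Qjs Qj hQ]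
    simp only [mj, LinearMap.add_apply, LinearMap.smul_apply, LinearMap.comp_apply, inner_add_left,
      inner_add_right, inner_smul_left, inner_smul_right, hlap, hxy, RCLike.conj_to_real]
  have hfun : (fun l => Real.exp (-(1 / 2) * aj * ‖emb ω - Qj l‖ ^ 2 - (1 / 2) * ⟪l, lap l⟫_ℝ + ⟪l, f⟫_ℝ)) =
      fun l => Real.exp (-(1 / 2) * aj * ‖emb ω‖ ^ 2) *
        Real.exp (-(1 / 2) * ⟪l, mj lap Qj Qjs aj l⟫_ℝ + ⟪l, f + aj • Qjs (emb ω)⟫_ℝ) := by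
    funext l
    rw [exponent241 lap Qj Qjs emb aj hQ ω f l, ← Real.exp_add]
    ring_nf
  rw [hfun, integral_const_mul, B6Eq295.integral_exp_quadratic_add_linear μ _ Gj hMsym hG, ← mul_assoc,
    ← Real.exp_add]
  congr 2
  -- expand ½⟨J, G_j J⟩ for J = f + a_j Q′_j* emb ω
  have hs : ⟪f, Gj (Qjs (emb ω))⟫_ℝ = ⟪Qjs (emb ω), Gj f⟫_ℝ := by rw [← hGsym, real_inner_comm]
  simp only [map_add, map_smul, inner_add_left, inner_add_right, inner_smul_left, inner_smul_right, hs,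
    RCLike.conj_to_real]
  ring

omit [MeasurableSpace V] [MeasurableAdd V] in
/-- **(2.42), second and third lines (the ω-integral).**  With `(C_Λ^{(j)}(□))⁻¹ = B₀ − a_j²·embs Q′_jG′_jQ′_j*emb`
symmetric, `C` a right inverse, and ANY left-invariant `dω`:
`∫dω exp[−½⟨ω,C⁻¹ω⟩ + a_j⟨ω, embs Q′_jG′_jf⟩] = exp[½a_j²⟨embs Q′_jG′_jf, C embs Q′_jG′_jf⟩]·∫dω e^{−½⟨ω,C⁻¹ω⟩}`
(print: source `⟨ω,Q′_jG′_j(□)f⟩` and result `exp⟨f,G′_jQ′_j*CQ′_jG′_jf⟩`).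
[cite: Balaban1984PropagatorsII, (2.42) p.230] -/
theorem eq242_outer (ν : Measure W) [ν.IsAddLeftInvariant] (Cinv C : W →ₗ[ℝ] W)
    (hCsym : ∀ x y : W, ⟪Cinv x, y⟫_ℝ = ⟪x, Cinv y⟫_ℝ) (hC : Cinv ∘ₗ C = LinearMap.id) (aj : ℝ) (g : W) :
    ∫ w, Real.exp (-(1 / 2) * ⟪w, Cinv w⟫_ℝ + aj * ⟪w, g⟫_ℝ) ∂ν =
      Real.exp ((1 / 2) * (aj * aj) * ⟪g, C g⟫_ℝ) * ∫ w, Real.exp (-(1 / 2) * ⟪w, Cinv w⟫_ℝ) ∂ν := by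
  have hfun : (fun w => Real.exp (-(1 / 2) * ⟪w, Cinv w⟫_ℝ + aj * ⟪w, g⟫_ℝ)) =
      fun w => Real.exp (-(1 / 2) * ⟪w, Cinv w⟫_ℝ + ⟪w, aj • g⟫_ℝ) := by
    funext w; rw [inner_smul_right]
  rw [hfun, B6Eq295.integral_exp_quadratic_add_linear ν Cinv C hCsym hC (aj • g)]
  congr 2
  rw [map_smul, inner_smul_left, inner_smul_right, RCLike.conj_to_real]
  ring

/-- **(2.41) ⇒ (2.42), assembled (iterated integral, ω outside as printed).**  Under the hypotheses of `eq242_inner`,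
with `Bq` symmetric, `C⁻¹ = cInv` (symmetric — proved from the symmetries) and `C` a right inverse of it:
`∫dω e^{−½⟨ω,Bqω⟩} ∫dλ exp[−½a_j‖emb ω − Q′_jλ‖² − ½⟨λ,Δλ⟩ + ⟨λ,f⟩]`
`= exp[½⟨f,G′_jf⟩ + ½a_j²⟨embs Q′_jG′_jf, C embs Q′_jG′_jf⟩] · Z_j · Z_C`,
`Z_j = ∫dλ e^{−½⟨λ,M_jλ⟩}`, `Z_C = ∫dω e^{−½⟨ω,C⁻¹ω⟩}`.  [cite: Balaban1984PropagatorsII, (2.41)–(2.42) p.230] -/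
theorem eq242 (μ : Measure V) [μ.IsAddLeftInvariant] (ν : Measure W) [ν.IsAddLeftInvariant] (lap : V →ₗ[ℝ] V)
    (Qj : V →ₗ[ℝ] U) (Qjs : U →ₗ[ℝ] V) (emb : W →ₗ[ℝ] U) (embs : U →ₗ[ℝ] W) (Bq : W →ₗ[ℝ] W) (Gj : V →ₗ[ℝ] V)
    (C : W →ₗ[ℝ] W) (aj : ℝ) (hQ : ∀ (u : U) (v : V), ⟪Qjs u, v⟫_ℝ = ⟪u, Qj v⟫_ℝ)
    (hE : ∀ (u : U) (w : W), ⟪embs u, w⟫_ℝ = ⟪u, emb w⟫_ℝ) (hlap : ∀ x y : V, ⟪lap x, y⟫_ℝ = ⟪x, lap y⟫_ℝ)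
    (hBq : ∀ x y : W, ⟪Bq x, y⟫_ℝ = ⟪x, Bq y⟫_ℝ) (hG : mj lap Qj Qjs aj ∘ₗ Gj = LinearMap.id)
    (hGsym : ∀ x y : V, ⟪Gj x, y⟫_ℝ = ⟪x, Gj y⟫_ℝ) (hC : cInv Qj Qjs emb embs Bq Gj aj ∘ₗ C = LinearMap.id) (f : V) :
    ∫ w, Real.exp (-(1 / 2) * ⟪w, Bq w⟫_ℝ) *
        ∫ l, Real.exp (-(1 / 2) * aj * ‖emb w - Qj l‖ ^ 2 - (1 / 2) * ⟪l, lap l⟫_ℝ + ⟪l, f⟫_ℝ) ∂μ ∂ν =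
      Real.exp ((1 / 2) * ⟪f, Gj f⟫_ℝ +
          (1 / 2) * (aj * aj) * ⟪embs (Qj (Gj f)), C (embs (Qj (Gj f)))⟫_ℝ) *
        ((∫ l, Real.exp (-(1 / 2) * ⟪l, mj lap Qj Qjs aj l⟫_ℝ) ∂μ) *
          ∫ w, Real.exp (-(1 / 2) * ⟪w, cInv Qj Qjs emb embs Bq Gj aj w⟫_ℝ) ∂ν) := by
  -- the ω-exponent collected: −½⟨ω,Bqω⟩ − ½a_j‖emb ω‖² + ½a_j²⟨Q*emb ω, G Q*emb ω⟩ = −½⟨ω, C⁻¹ ω⟩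
  have hωexp : ∀ w : W, -(1 / 2) * ⟪w, Bq w⟫_ℝ + (-(1 / 2) * aj * ‖emb w‖ ^ 2 +
      (1 / 2) * (aj * aj) * ⟪Qjs (emb w), Gj (Qjs (emb w))⟫_ℝ) =
      -(1 / 2) * ⟪w, cInv Qj Qjs emb embs Bq Gj aj w⟫_ℝ := by
    intro w
    have h1 : ⟪w, embs (emb w)⟫_ℝ = ‖emb w‖ ^ 2 := by
      rw [real_inner_comm, hE, real_inner_self_eq_norm_sq]
    have h2 : ⟪w, embs (Qj (Gj (Qjs (emb w))))⟫_ℝ = ⟪Qjs (emb w), Gj (Qjs (emb w))⟫_ℝ := by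
      rw [adj_swap embs emb hE, ← hQ]
    simp only [cInv, b0, LinearMap.sub_apply, LinearMap.add_apply, LinearMap.smul_apply, LinearMap.comp_apply,
      inner_sub_right, inner_add_right, inner_smul_right, h1, h2]
    ring
  -- the source term: a_j⟨Q′_j*emb ω, G′_jf⟩ = a_j⟨ω, embs Q′_jG′_jf⟩
  have hsrc : ∀ w : W, ⟪Qjs (emb w), Gj f⟫_ℝ = ⟪w, embs (Qj (Gj f))⟫_ℝ := by
    intro w; rw [hQ, ← adj_swap embs emb hE]
  -- C⁻¹ is symmetric
  have hCsym : ∀ x y : W, ⟪cInv Qj Qjs emb embs Bq Gj aj x, y⟫_ℝ = ⟪x, cInv Qj Qjs emb embs Bq Gj aj y⟫_ℝ := by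
    intro x y
    have h1 : ⟪embs (emb x), y⟫_ℝ = ⟪x, embs (emb y)⟫_ℝ := by
      rw [hE, ← adj_swap embs emb hE]
    have h2 : ⟪embs (Qj (Gj (Qjs (emb x)))), y⟫_ℝ = ⟪x, embs (Qj (Gj (Qjs (emb y))))⟫_ℝ := by
      rw [hE, ← adj_swap Qjs Qj hQ, hGsym, hQ, ← adj_swap embs emb hE]
    simp only [cInv, b0, LinearMap.sub_apply, LinearMap.add_apply, LinearMap.smul_apply, LinearMap.comp_apply,
      inner_sub_left, inner_add_left, inner_smul_left, inner_sub_right, inner_add_right, inner_smul_right, hBq,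
      h1, h2, RCLike.conj_to_real]
  -- step 1: the inner λ-integral (first line of (2.42)), multiplied by the ω-weight e^{−½⟨ω,Bqω⟩}
  have hinner : ∀ w : W,
      Real.exp (-(1 / 2) * ⟪w, Bq w⟫_ℝ) *
        ∫ l, Real.exp (-(1 / 2) * aj * ‖emb w - Qj l‖ ^ 2 - (1 / 2) * ⟪l, lap l⟫_ℝ + ⟪l, f⟫_ℝ) ∂μ =
      (Real.exp ((1 / 2) * ⟪f, Gj f⟫_ℝ) * ∫ l, Real.exp (-(1 / 2) * ⟪l, mj lap Qj Qjs aj l⟫_ℝ) ∂μ) *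
        Real.exp (-(1 / 2) * ⟪w, cInv Qj Qjs emb embs Bq Gj aj w⟫_ℝ + aj * ⟪w, embs (Qj (Gj f))⟫_ℝ) := by
    intro w
    rw [eq242_inner μ lap Qj Qjs emb Gj aj hQ hlap hG hGsym w f, hsrc w]
    have hexp : Real.exp (-(1 / 2) * ⟪w, Bq w⟫_ℝ) *
        Real.exp ((1 / 2) * ⟪f, Gj f⟫_ℝ - (1 / 2) * aj * ‖emb w‖ ^ 2 +
          (1 / 2) * (aj * aj) * ⟪Qjs (emb w), Gj (Qjs (emb w))⟫_ℝ + aj * ⟪w, embs (Qj (Gj f))⟫_ℝ) =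
        Real.exp ((1 / 2) * ⟪f, Gj f⟫_ℝ) *
          Real.exp (-(1 / 2) * ⟪w, cInv Qj Qjs emb embs Bq Gj aj w⟫_ℝ + aj * ⟪w, embs (Qj (Gj f))⟫_ℝ) := by
      rw [← Real.exp_add, ← Real.exp_add, ← hωexp w]
      congr 1
      ring
    rw [← mul_assoc, hexp]
    ring
  have hfun : (fun w : W => Real.exp (-(1 / 2) * ⟪w, Bq w⟫_ℝ) *
        ∫ l, Real.exp (-(1 / 2) * aj * ‖emb w - Qj l‖ ^ 2 - (1 / 2) * ⟪l, lap l⟫_ℝ + ⟪l, f⟫_ℝ) ∂μ) =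
      fun w => (Real.exp ((1 / 2) * ⟪f, Gj f⟫_ℝ) * ∫ l, Real.exp (-(1 / 2) * ⟪l, mj lap Qj Qjs aj l⟫_ℝ) ∂μ) *
        Real.exp (-(1 / 2) * ⟪w, cInv Qj Qjs emb embs Bq Gj aj w⟫_ℝ + aj * ⟪w, embs (Qj (Gj f))⟫_ℝ) :=
    funext hinner
  -- step 2: the ω-integral (second and third lines of (2.42))
  rw [hfun, integral_const_mul, eq242_outer ν _ C hCsym hC aj (embs (Qj (Gj f))), Real.exp_add]
  ring

/-- **(2.42) names `G′(□)`**: the exponent produced by the Gaussian route IS `½⟨f,G′(□)f⟩` for the Woodbury operator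
`gPrimeBox` of §1 (so the three lines of (2.42) compute `e^{½⟨f,G′(□)f⟩}` up to the constant `Z_jZ_C`, as printed up
to the coefficient `½a_j²`). [cite: Balaban1984PropagatorsII, (2.42) p.230] -/
theorem eq242_gPrimeBox (μ : Measure V) [μ.IsAddLeftInvariant] (ν : Measure W) [ν.IsAddLeftInvariant]
    (lap : V →ₗ[ℝ] V) (Qj : V →ₗ[ℝ] U) (Qjs : U →ₗ[ℝ] V) (emb : W →ₗ[ℝ] U) (embs : U →ₗ[ℝ] W) (Bq : W →ₗ[ℝ] W)
    (Gj : V →ₗ[ℝ] V) (C : W →ₗ[ℝ] W) (aj : ℝ) (hQ : ∀ (u : U) (v : V), ⟪Qjs u, v⟫_ℝ = ⟪u, Qj v⟫_ℝ)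
    (hE : ∀ (u : U) (w : W), ⟪embs u, w⟫_ℝ = ⟪u, emb w⟫_ℝ) (hlap : ∀ x y : V, ⟪lap x, y⟫_ℝ = ⟪x, lap y⟫_ℝ)
    (hBq : ∀ x y : W, ⟪Bq x, y⟫_ℝ = ⟪x, Bq y⟫_ℝ) (hG : mj lap Qj Qjs aj ∘ₗ Gj = LinearMap.id)
    (hGsym : ∀ x y : V, ⟪Gj x, y⟫_ℝ = ⟪x, Gj y⟫_ℝ) (hC : cInv Qj Qjs emb embs Bq Gj aj ∘ₗ C = LinearMap.id) (f : V) :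
    ∫ w, Real.exp (-(1 / 2) * ⟪w, Bq w⟫_ℝ) *
        ∫ l, Real.exp (-(1 / 2) * aj * ‖emb w - Qj l‖ ^ 2 - (1 / 2) * ⟪l, lap l⟫_ℝ + ⟪l, f⟫_ℝ) ∂μ ∂ν =
      Real.exp ((1 / 2) * ⟪f, gPrimeBox Qj Qjs emb embs Gj C aj f⟫_ℝ) *
        ((∫ l, Real.exp (-(1 / 2) * ⟪l, mj lap Qj Qjs aj l⟫_ℝ) ∂μ) *
          ∫ w, Real.exp (-(1 / 2) * ⟪w, cInv Qj Qjs emb embs Bq Gj aj w⟫_ℝ) ∂ν) := by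
  rw [eq242 μ ν lap Qj Qjs emb embs Bq Gj C aj hQ hE hlap hBq hG hGsym hC f,
    form242 Qj Qjs emb embs Gj C aj hQ hGsym f]
  have h : ⟪Qj (Gj f), emb (C (embs (Qj (Gj f))))⟫_ℝ = ⟪embs (Qj (Gj f)), C (embs (Qj (Gj f)))⟫_ℝ := by
    rw [← hE, real_inner_comm]
  rw [h]
  congr 2
  ring

/-! ## §4. The ω-representation behind the second equality of (2.41) -/

omit [MeasurableSpace V] [MeasurableAdd V] in
/-- **(2.41), the intermediate-field representation of the two-level averaging form** (the abstract skeleton of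
*"On the basis of the formulas (2.12), (2.13) [1]"*): for `Bq` symmetric, `embs` the adjoint of `emb`, `B₀⁻¹` a right
inverse of the symmetric `B₀ = Bq + a_j·embs emb`, and ANY left-invariant `dω`, for every block field `u` (= `Q′_jλ`):
`∫dω exp[−½⟨ω,Bqω⟩ − ½a_j‖emb ω − u‖²] = exp[−½⟨u,Ku⟩] · ∫dω e^{−½⟨ω,B₀ω⟩}`, `K = a_j − a_j²·emb B₀⁻¹ embs`; hence the
λ-integrand of the first line of (2.41) with `Q′*aQ′↾_□ := Q′_j*KQ′_j` is `Z_{B₀}⁻¹ ×` the ω-integral of the second line.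
[cite: Balaban1984PropagatorsII, (2.41) p.230] -/
theorem eq241_fibre (ν : Measure W) [ν.IsAddLeftInvariant] (emb : W →ₗ[ℝ] U) (embs : U →ₗ[ℝ] W)
    (Bq B0inv : W →ₗ[ℝ] W) (aj : ℝ) (hE : ∀ (u : U) (w : W), ⟪embs u, w⟫_ℝ = ⟪u, emb w⟫_ℝ)
    (hBq : ∀ x y : W, ⟪Bq x, y⟫_ℝ = ⟪x, Bq y⟫_ℝ) (hB : b0 Bq emb embs aj ∘ₗ B0inv = LinearMap.id) (u : U) :
    ∫ w, Real.exp (-(1 / 2) * ⟪w, Bq w⟫_ℝ - (1 / 2) * aj * ‖emb w - u‖ ^ 2) ∂ν =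
      Real.exp (-(1 / 2) * ⟪u, kForm emb embs B0inv aj u⟫_ℝ) *
        ∫ w, Real.exp (-(1 / 2) * ⟪w, b0 Bq emb embs aj w⟫_ℝ) ∂ν := by
  have hB0sym : ∀ x y : W, ⟪b0 Bq emb embs aj x, y⟫_ℝ = ⟪x, b0 Bq emb embs aj y⟫_ℝ := by
    intro x y
    have h1 : ⟪embs (emb x), y⟫_ℝ = ⟪x, embs (emb y)⟫_ℝ := by
      rw [hE, ← adj_swap embs emb hE]
    simp only [b0, LinearMap.add_apply, LinearMap.smul_apply, LinearMap.comp_apply, inner_add_left,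
      inner_add_right, inner_smul_left, inner_smul_right, hBq, h1, RCLike.conj_to_real]
  -- the exponent: −½⟨ω,Bqω⟩ − ½a_j‖emb ω − u‖² = −½⟨ω,B₀ω⟩ + ⟨ω, a_j embs u⟩ − ½a_j‖u‖²
  have hexp : ∀ w : W, -(1 / 2) * ⟪w, Bq w⟫_ℝ - (1 / 2) * aj * ‖emb w - u‖ ^ 2 =
      (-(1 / 2) * ⟪w, b0 Bq emb embs aj w⟫_ℝ + ⟪w, aj • embs u⟫_ℝ) + -(1 / 2) * aj * ‖u‖ ^ 2 := by
    intro w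
    have h1 : ⟪w, embs (emb w)⟫_ℝ = ‖emb w‖ ^ 2 := by rw [real_inner_comm, hE, real_inner_self_eq_norm_sq]
    have h2 : ⟪w, embs u⟫_ℝ = ⟪emb w, u⟫_ℝ := by rw [real_inner_comm, hE, real_inner_comm]
    have h3 : ‖emb w - u‖ ^ 2 = ‖emb w‖ ^ 2 - 2 * ⟪emb w, u⟫_ℝ + ‖u‖ ^ 2 := norm_sub_sq_real (emb w) u
    simp only [b0, LinearMap.add_apply, LinearMap.smul_apply, LinearMap.comp_apply, inner_add_right,
      inner_smul_right, h1, h2, h3]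
    ring
  have hfun : (fun w : W => Real.exp (-(1 / 2) * ⟪w, Bq w⟫_ℝ - (1 / 2) * aj * ‖emb w - u‖ ^ 2)) =
      fun w => Real.exp (-(1 / 2) * aj * ‖u‖ ^ 2) *
        Real.exp (-(1 / 2) * ⟪w, b0 Bq emb embs aj w⟫_ℝ + ⟪w, aj • embs u⟫_ℝ) := by
    funext w
    rw [hexp w, Real.exp_add, mul_comm]
  rw [hfun, integral_const_mul, B6Eq295.integral_exp_quadratic_add_linear ν _ B0inv hB0sym hB (aj • embs u),
    ← mul_assoc, ← Real.exp_add]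
  congr 2
  have h4 : ⟪embs u, B0inv (embs u)⟫_ℝ = ⟪u, emb (B0inv (embs u))⟫_ℝ := by rw [hE]
  simp only [kForm, map_smul, LinearMap.sub_apply, LinearMap.smul_apply, LinearMap.comp_apply,
    LinearMap.id_apply, inner_sub_right, inner_smul_left, inner_smul_right, real_inner_self_eq_norm_sq, h4,
    RCLike.conj_to_real]
  ring

end Gaussian

end Literature.MathematicalPhysics.QuantumFieldTheory.Balaban1983to89.B6Eq242LocalPropagator
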